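import Summits.QuantumFields.YangMills.Theorems.AlphaInputsT3ACv3SphereAxialGauge
import Summits.QuantumFields.YangMills.Theorems.AlphaInputsT3ACv3ModelBoxLog
import HarnessLib

/-!
# `AlphaInputsT3ACv3BallSystem` — START v3.1 for the (FL) `hLift` binder, row (S5), part 3′: **THE d = 3 SEAM (S3) ∘ (S4) — THE BALL MODEL FIELD OF ONE VERTEX CUBE**:
# `ballModel R b U := startGauged R σ U` with σ a sphere axial gauge of ★w5 g2's `exists_sphereAxialGauge` (chosen classically when it exists, else `U`); from `dist1 (plaqB U) ≤ b` on the
# boundary plaquettes of the cube (`1 ≤ R`, `320R²b ≤ 1`, `4800Rb ≤ 1`, `|n|·200Rb < π`): ★ (hM) `ballModel = U` on the tangential boundary bonds `BdryBond R`, ★★ (hP) every box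
# plaquette has `dist1 ≤ 81601·b` — the two model inputs of `…v3BallGraft.ballField_eq_of_not_all` ∕ `dist1_plaqHol_ballField_le_of_bonds` — lane `pub-balaban3d` ∕ cell `ym3-torus`,
# seat `ym-ust-19936-w1` (g2, LEAD)

WHY (bus 03:19:23Z ★w5 g2 (S3) 4∕4; 03:36Z PROGRESS 4).  (S3) `SphereAxialGauge.exists_sphereAxialGauge`: boundary plaquettes `≤ b` ⟹ a gauge σ with `dist1 (gaugeB σ U) ≤ 200Rb` on
`BdryBond R`; (S4)+seam ★w3 `ModelBox.startGauged R σ U` (exponential Coons fill of the σ-gauged boundary logarithms, gauged back): `= U` on `BdryBond R`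
(`startGauged_eq_of_bdryBond`, window `ρ ≤ 1/4`, `|n|ρ < π`) and box plaquettes `≤ b′ + 8ρ∕R + 640ρ²` (`dist1_plaqB_startGauged_le`, `24ρ ≤ 1`).  THIS FILE fixes σ by choice
inside ONE proof-free definition and does the arithmetic `ρ = 200Rb`: `8ρ∕R = 1600b`, `640ρ² = 2.56·10⁷·R²b·b ≤ 8·10⁴·b`.  In the START (B) it is used at `U := pullB v tubeSec` for
the cube of half-side `R ≍ L^k∕8` around an interior vertex `v` (instantiated at `P := F.P K`, `(F.P K).d = 3` by `rfl`), `b ≍ ε′·L^{−2k}`: the rows `320R²b ≤ 1`, `4800Rb ≤ 1`,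
`|n|·200Rb < π` are `O(ε′)`-smallness, absolute.
WHAT IS HERE: `ballModel` (def), `ballModel_eq_of_exists`, ★`ballModel_eq_of_bdryBond` (hM), ★★`dist1_plaqB_ballModel_le` (`≤ b + 1600b + 640(200Rb)²`) and `dist1_plaqB_ballModel_le'`
(`≤ 81601·b`).
HONEST FRAMING.  Bookkeeping over (S3)∕(S4); no new estimate; (FL)∕`hLift` NOT proved; count-neutral helper toward R3 2′ (items 19936∕19935); registry untouched; nothing about d = 4,
the continuum, or a mass gap; YM₃ on T³ is rung R3, not Clay.

References: T. Bałaban, Commun. Math. Phys. 102 (1985) 277–309 [Balaban1985Variational] ((8), (11)–(14) pp.279–280); Commun. Math. Phys. 98 (1985) 17–51 [Balaban1985Averaging]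
((8)–(9) p.19, (19)–(23) p.21).
-/

set_option autoImplicit false

noncomputable section

open scoped Matrix.Norms.L2Operator

namespace Summit.QuantumFields.YangMills.Theorems.TubeStart

open Literature.MathematicalPhysics.QuantumFieldTheory.Balaban1983to89
open Summit.QuantumFields.YangMills.Theorems.ModelBox
open Summit.QuantumFields.YangMills.Theorems.SphereAxialGauge (exists_sphereAxialGauge)

variable {n : Type*} [Fintype n] [DecidableEq n] [Nonempty n]

open Classical in
/-- **THE BALL MODEL FIELD OF ONE VERTEX CUBE**: `startGauged R σ U` for a classically chosen sphere axial gauge σ with `dist1 (gaugeB σ U) ≤ 200Rb` on the tangential boundary bonds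
(when one exists — (S3) — else `U` itself). [cite: Balaban1985Variational, (8)+(11)–(13) pp.279–280] -/
def ballModel (R : ℕ) (b : ℝ) (U : (Fin 3 → ℤ) → Fin 3 → Matrix.specialUnitaryGroup n ℂ) : (Fin 3 → ℤ) → Fin 3 → Matrix.specialUnitaryGroup n ℂ :=
  if h : ∃ σ : (Fin 3 → ℤ) → Matrix.specialUnitaryGroup n ℂ, ∀ (u : Fin 3 → ℤ) (μ : Fin 3), BdryBond R u μ → GaugeGroup.dist1 (gaugeB σ U u μ) ≤ 200 * R * b then
    startGauged R (Classical.choose h) U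
  else U

/-- Unfolding the choice. [folklore] -/
theorem ballModel_eq_of_exists {R : ℕ} {b : ℝ} {U : (Fin 3 → ℤ) → Fin 3 → Matrix.specialUnitaryGroup n ℂ}
    (h : ∃ σ : (Fin 3 → ℤ) → Matrix.specialUnitaryGroup n ℂ, ∀ (u : Fin 3 → ℤ) (μ : Fin 3), BdryBond R u μ → GaugeGroup.dist1 (gaugeB σ U u μ) ≤ 200 * R * b) :
    ballModel R b U = startGauged R (Classical.choose h) U := by
  classical
  unfold ballModel
  rw [dif_pos h]

section Bounds

variable {R : ℕ} (hR : 1 ≤ R) (U : (Fin 3 → ℤ) → Fin 3 → Matrix.specialUnitaryGroup n ℂ) {b : ℝ} (hb : 0 ≤ b) (hsmall : 320 * (R : ℝ) ^ 2 * b ≤ 1)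
  (h4800 : 4800 * (R : ℝ) * b ≤ 1) (hπ : (Fintype.card n : ℝ) * (200 * R * b) < Real.pi) (hU : ∀ (u : Fin 3 → ℤ) (μ ν : Fin 3), BdryPlaq R u μ ν → GaugeGroup.dist1 (plaqB U u μ ν) ≤ b)
include hR hb hsmall h4800 hπ hU

omit h4800 hπ in
/-- (S3)'s existence, re-exported in this file's letters (its window `|n|·20R²b < π` is asked separately from the log window `|n|·200Rb < π`). [cite: Balaban1985Averaging, (19)–(23) p.21] -/
theorem exists_sigma_of_rows (hπ' : (Fintype.card n : ℝ) * (20 * (R : ℝ) ^ 2 * b) < Real.pi) :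
    ∃ σ : (Fin 3 → ℤ) → Matrix.specialUnitaryGroup n ℂ, ∀ (u : Fin 3 → ℤ) (μ : Fin 3), BdryBond R u μ → GaugeGroup.dist1 (gaugeB σ U u μ) ≤ 200 * R * b :=
  exists_sphereAxialGauge R hR U hb hsmall hπ' hU

/-- **★ (hM) ON THE TANGENTIAL BOUNDARY BONDS THE BALL MODEL FIELD IS `U`.** [cite: Balaban1985Variational, (11)–(13) pp.279–280] -/
theorem ballModel_eq_of_bdryBond (hπ' : (Fintype.card n : ℝ) * (20 * (R : ℝ) ^ 2 * b) < Real.pi) {u : Fin 3 → ℤ} {μ : Fin 3} (hbd : BdryBond R u μ) :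
    ballModel R b U u μ = U u μ := by
  have h := exists_sigma_of_rows hR U hb hsmall hU hπ'
  have hR0 : R ≠ 0 := by omega
  have hRr : (1 : ℝ) ≤ R := by exact_mod_cast hR
  have hρ4 : 200 * (R : ℝ) * b ≤ 1 / 4 := by nlinarith
  rw [ballModel_eq_of_exists h]
  exact startGauged_eq_of_bdryBond hR0 _ U (Classical.choose_spec h) hρ4 hπ hbd

/-- **★★ (hP) EVERY BOX PLAQUETTE OF THE BALL MODEL FIELD IS SMALL**: `dist1 ≤ b + 1600·b + 640·(200Rb)²`. [cite: Balaban1985Variational, (8)+(11)–(14) pp.279–280] -/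
theorem dist1_plaqB_ballModel_le (hπ' : (Fintype.card n : ℝ) * (20 * (R : ℝ) ^ 2 * b) < Real.pi) {u : Fin 3 → ℤ} {μ ν : Fin 3} (hμν : μ ≠ ν) (hu : PlaqInBox R u μ ν) :
    GaugeGroup.dist1 (plaqB (ballModel R b U) u μ ν) ≤ b + 1600 * b + 640 * (200 * R * b) ^ 2 := by
  have h := exists_sigma_of_rows hR U hb hsmall hU hπ'
  have hR0 : R ≠ 0 := by omega
  have hRr : (1 : ℝ) ≤ R := by exact_mod_cast hR
  have hρ : (0 : ℝ) ≤ 200 * R * b := by positivity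
  have h24 : 24 * (200 * (R : ℝ) * b) ≤ 1 := by nlinarith
  rw [ballModel_eq_of_exists h]
  have key := dist1_plaqB_startGauged_le hR0 (Classical.choose h) U hρ h24 hπ (Classical.choose_spec h) hU hμν hu
  have hRpos : (0 : ℝ) < R := by linarith
  calc GaugeGroup.dist1 (plaqB (startGauged R (Classical.choose h) U) u μ ν) ≤ b + 8 * (200 * R * b) / R + 640 * (200 * R * b) ^ 2 := key
    _ = b + 1600 * b + 640 * (200 * R * b) ^ 2 := by field_simp; ring

/-- The same with an absolute constant: `dist1 ≤ 81601·b` (using `320R²b ≤ 1`). [cite: Balaban1985Variational, (14) p.280] -/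
theorem dist1_plaqB_ballModel_le' (hπ' : (Fintype.card n : ℝ) * (20 * (R : ℝ) ^ 2 * b) < Real.pi) {u : Fin 3 → ℤ} {μ ν : Fin 3} (hμν : μ ≠ ν) (hu : PlaqInBox R u μ ν) :
    GaugeGroup.dist1 (plaqB (ballModel R b U) u μ ν) ≤ 81601 * b := by
  have h := dist1_plaqB_ballModel_le hR U hb hsmall h4800 hπ hU hπ' hμν hu
  have h2 : 640 * (200 * (R : ℝ) * b) ^ 2 = 80000 * (320 * (R : ℝ) ^ 2 * b) * b := by ring
  have h3 : 80000 * (320 * (R : ℝ) ^ 2 * b) * b ≤ 80000 * 1 * b := by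
    apply mul_le_mul_of_nonneg_right _ hb
    exact mul_le_mul_of_nonneg_left hsmall (by norm_num)
  linarith

end Bounds

end Summit.QuantumFields.YangMills.Theorems.TubeStart

end
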